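import Literature.NumberTheory.EllipticCurves.Greenberg1999.TwoTorsionOddCriterionProofs
import HarnessLib

/-!
# The sign of `Δ` along a `ℤ/2`-linked pair: the partner's discriminant has the sign of
# `β = b₄ + x b₂ + 6x²`; a pair never has both discriminants negative (proofs only)

Topic `NumberTheory/EllipticCurves/Greenberg1999`; theorem-only companion (no definition, no named fact, no instance,
no `sorry`) of the configuration files (`TwoTorsion{Odd,Ramified}IsogenyDualProofs`, `…OddCriterionProofs`,
`…DiscriminantConfigurationProofs`).  Greenberg's proof of Prop. 5.14 (LNM 1716 pp. 121–123) splits by the number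
of connected components of `E(ℝ)` (`sign Δ`); here that datum is tracked across the `2`-isogeny `P ↦ P'`.

Setting as in the siblings: `C • W` a two-torsion normal form (`P = (C.r, C.t)`, `a = a₂`, `b = a₄`),
`C' • W' = (C • W).twoIsogenyCodomain`.  Then `Δ(C • W) = 16b²(a² − 4b)` and `Δ((C • W)') = 256 b (a² − 4b)²`
(tree `Δ_of_isTwoTorsionNF`, `twoIsogenyCodomain_Δ`), so `sign Δ(W) = sign(a² − 4b) = sign(α² − 32β)` and
**`sign Δ(W') = sign b = sign β`**, `β = b₄ + x(P)b₂ + 6x(P)²`.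

**Theorems.**
* `Δ_partner_pos_iff` / `Δ_partner_neg_iff` — `0 < Δ(W') ⟺ 0 < β`, `Δ(W') < 0 ⟺ β < 0`.
* `Δ_partner_pos_of_twoTorsionOdd` — if `⟨P⟩` is odd then `Δ(W') > 0` (`β > 0` by the sign test); likewise for
  co-odd; hence **`Δ_pos_or_Δ_partner_pos`: a `ℤ/2`-linked pair never has both discriminants negative**
  (`Δ(W) < 0` makes `P` odd).  `Δ_partner_neg_iff_middle` — `Δ(W') < 0` iff `P` is the MIDDLE real
  `2`-torsion abscissa (neither least nor largest), and then `Δ(W) > 0`.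

Written for the BSD cell `bsd-2adic` (stratum (β): which member of a pair has `E(ℝ)` connected).  Nothing about
BSD, `μ` or `λ` is claimed.

## References
* [GreenbergLNM1716] R. Greenberg, *Iwasawa theory for elliptic curves*, LNM 1716 (1999), §5 Remark and proof
  of Prop. 5.14 (chunks p0170–p0173).
* [SilvermanAEC2009] J. H. Silverman, *AEC*, III.4 Example 4.5 (`Δ(E₁)`, `Δ(E₂)`).
-/

set_option autoImplicit false

open WeierstrassCurve

namespace Literature.NumberTheory.EllipticCurves.Greenberg1999

section PartnerSign

variable (W W' : WeierstrassCurve ℚ) [W.IsElliptic] (C C' : VariableChange ℚ)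

/-- **`sign Δ(W') = sign β`**: `0 < Δ(W') ⟺ 0 < b₄ + x(P) b₂ + 6x(P)²` (`Δ(V') = 256 b (a² − 4b)²`, `2b = u⁻⁴β`).
[cite: SilvermanAEC2009, III.4 Example 4.5] -/
theorem Δ_partner_pos_iff [(C • W).IsTwoTorsionNF] (hlink : C' • W' = (C • W).twoIsogenyCodomain) :
    0 < W'.Δ ↔ 0 < W.b₄ + C.r * W.b₂ + 6 * C.r ^ 2 := by
  obtain ⟨hb, -, -, -⟩ := sign_nf_iff_sign W C
  rw [← Δ_smul_pos_iff W' C', hlink, twoIsogenyCodomain_Δ, ← hb]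
  have hD : (C • W).a₂ ^ 2 - 4 * (C • W).a₄ ≠ 0 := (C • W).a₂_sq_sub_ne_zero
  have hD2 : 0 < ((C • W).a₂ ^ 2 - 4 * (C • W).a₄) ^ 2 := by positivity
  constructor
  · intro h; by_contra h'; exact absurd h (not_lt.mpr (by nlinarith [not_lt.mp h']))
  · intro h; positivity

/-- `Δ(W') < 0 ⟺ β < 0`. [cite: SilvermanAEC2009, III.4 Example 4.5] -/
theorem Δ_partner_neg_iff [(C • W).IsTwoTorsionNF] (hlink : C' • W' = (C • W).twoIsogenyCodomain) :
    W'.Δ < 0 ↔ W.b₄ + C.r * W.b₂ + 6 * C.r ^ 2 < 0 := by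
  have hpos := Δ_partner_pos_iff W W' C C' hlink
  haveI : (C' • W').IsElliptic := by rw [hlink]; infer_instance
  have hW'0 : W'.Δ ≠ 0 := by
    have h := variableChange_Δ W' C'
    intro h0
    rw [h0, mul_zero] at h
    exact absurd h (by rw [← (C' • W').coe_Δ']; exact (C' • W').Δ'.ne_zero)
  have hβ0 : W.b₄ + C.r * W.b₂ + 6 * C.r ^ 2 ≠ 0 := by
    intro h0
    have h4 := two_mul_a₄_of_isTwoTorsionNF_smul W C
    rw [h0, mul_zero] at h4
    exact (C • W).a₄_ne_zero (by linarith)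
  constructor
  · intro h
    rcases lt_trichotomy (W.b₄ + C.r * W.b₂ + 6 * C.r ^ 2) 0 with hl | he | hg
    · exact hl
    · exact absurd he hβ0
    · exact absurd (hpos.mpr hg) (not_lt.mpr h.le)
  · intro h
    rcases lt_trichotomy W'.Δ 0 with hl | he | hg
    · exact hl
    · exact absurd he hW'0
    · exact absurd (hpos.mp hg) (not_lt.mpr h.le)

/-- **If `⟨P⟩` is odd, the partner has `Δ > 0`** (two real components): odd ⟹ `β > 0`.
[cite: GreenbergLNM1716, §5 Remark (chunk p0170) and proof of Prop. 5.14 (chunks p0171–p0173)] -/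
theorem Δ_partner_pos_of_twoTorsionOdd [(C • W).IsTwoTorsionNF] (hlink : C' • W' = (C • W).twoIsogenyCodomain)
    (hodd : TwoTorsionOdd W C.r) : 0 < W'.Δ :=
  (Δ_partner_pos_iff W W' C C' hlink).mpr ((twoTorsionOdd_iff_sign W C).mp hodd).1

/-- **If `⟨P⟩` is co-odd (`x(P)` the largest real `2`-torsion abscissa), the partner has `Δ > 0`.**
[cite: GreenbergLNM1716, §5 Remark (chunk p0174)] -/
theorem Δ_partner_pos_of_coodd [(C • W).IsTwoTorsionNF] (hlink : C' • W' = (C • W).twoIsogenyCodomain)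
    (hco : ∀ r : ℝ, 4 * r ^ 3 + (W.b₂ : ℝ) * r ^ 2 + 2 * (W.b₄ : ℝ) * r + (W.b₆ : ℝ) = 0 → r ≤ (C.r : ℝ)) :
    0 < W'.Δ :=
  (Δ_partner_pos_iff W W' C C' hlink).mpr ((forall_root_le_iff_sign W C).mp hco).1

/-- **A `ℤ/2`-linked pair never has both discriminants negative**: if `Δ(W) < 0` then `⟨P⟩` is odd and so
`Δ(W') > 0`. [cite: GreenbergLNM1716, §5 Remark (chunk p0170)] -/
theorem Δ_pos_or_Δ_partner_pos [(C • W).IsTwoTorsionNF] (hlink : C' • W' = (C • W).twoIsogenyCodomain) :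
    0 < W.Δ ∨ 0 < W'.Δ := by
  rcases lt_trichotomy W.Δ 0 with hl | he | hg
  · exact Or.inr (Δ_partner_pos_of_twoTorsionOdd W W' C C' hlink (twoTorsionOdd_smul_r_of_Δ_neg W C hl))
  · exact absurd he (by rw [← W.coe_Δ']; exact W.Δ'.ne_zero)
  · exact Or.inl hg

/-- **`Δ(W') < 0` iff `P` is the MIDDLE real `2`-torsion point** (neither the least nor the largest abscissa),
and then `Δ(W) > 0`. [cite: GreenbergLNM1716, §5 Remark (chunks p0170, p0174)] -/
theorem Δ_partner_neg_iff_middle [(C • W).IsTwoTorsionNF] (hlink : C' • W' = (C • W).twoIsogenyCodomain) :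
    W'.Δ < 0 ↔ (¬ TwoTorsionOdd W C.r ∧
      ¬ ∀ r : ℝ, 4 * r ^ 3 + (W.b₂ : ℝ) * r ^ 2 + 2 * (W.b₄ : ℝ) * r + (W.b₆ : ℝ) = 0 → r ≤ (C.r : ℝ)) := by
  rw [Δ_partner_neg_iff W W' C C' hlink, twoTorsionOdd_iff_sign W C, forall_root_le_iff_sign W C]
  set α := W.b₂ + 12 * C.r
  set β := W.b₄ + C.r * W.b₂ + 6 * C.r ^ 2
  have hβ0 : β ≠ 0 := by
    intro h0
    have h4 := two_mul_a₄_of_isTwoTorsionNF_smul W C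
    simp only [β] at h0
    rw [h0, mul_zero] at h4
    exact (C • W).a₄_ne_zero (by linarith)
  constructor
  · intro h
    exact ⟨fun h' ↦ absurd h'.1 (not_lt.mpr h.le), fun h' ↦ absurd h'.1 (not_lt.mpr h.le)⟩
  · rintro ⟨h1, h2⟩
    rcases lt_trichotomy β 0 with hl | he | hg
    · exact hl
    · exact absurd he hβ0
    · exfalso
      -- `β > 0`: then `α < 0 ∨ α² < 32β` fails and `0 < α ∨ α² < 32β` fails, so `α = 0` and `α² ≥ 32β > 0`.
      have hα1 : ¬ (α < 0 ∨ α ^ 2 < 32 * β) := fun h ↦ h1 ⟨hg, h⟩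
      have hα2 : ¬ (0 < α ∨ α ^ 2 < 32 * β) := fun h ↦ h2 ⟨hg, h⟩
      push Not at hα1 hα2
      have hα0 : α = 0 := le_antisymm hα2.1 hα1.1
      have : α ^ 2 < 32 * β := by rw [hα0]; nlinarith
      exact absurd this (not_lt.mpr hα1.2)

/-- Hence **the partner of a middle point has all its rational `2`-torsion points odd** (its `Δ` is negative).
[cite: GreenbergLNM1716, §5 Remark (chunk p0170)] -/
theorem twoTorsionOdd_partner_of_middle [W'.IsElliptic] [(C • W).IsTwoTorsionNF]
    (hlink : C' • W' = (C • W).twoIsogenyCodomain) (h1 : ¬ TwoTorsionOdd W C.r)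
    (h2 : ¬ ∀ r : ℝ, 4 * r ^ 3 + (W.b₂ : ℝ) * r ^ 2 + 2 * (W.b₄ : ℝ) * r + (W.b₆ : ℝ) = 0 → r ≤ (C.r : ℝ))
    {x : ℚ} (hx : HasRationalTwoTorsionX W' x) : TwoTorsionOdd W' x :=
  twoTorsionOdd_of_Δ_neg W' ((Δ_partner_neg_iff_middle W W' C C' hlink).mpr ⟨h1, h2⟩) hx

end PartnerSign

end Literature.NumberTheory.EllipticCurves.Greenberg1999
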